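import Mathlib

/-!
# Solo-blind seat, s15 anchor 2: central twists preserve the TPP; sign of the Borel-pair second-order form

Companion to `paper/LieExponent.md` §3.21(g) (solo-blind seat `solo-MatrixMultiplication-blind`, s15).

* `soloLie_central_twist_tpp` — the abstract (group-level) form of the CENTRAL TWIST lemma: if
  `(M₁, M₂, H₃)` satisfies the triple product property with `H₃` a subgroup, and `z : G → G` takes values
  in `center G ⊓ H₃` on `M₁`, then the twisted first member `{z m * m}` together with `M₂, H₃` again
  satisfies it.  (Used in §3.21(g) to produce non-subalgebra exp-germ TPP triples at the count of
  Theorem 1, so that rigidity must be read modulo central twists.)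
* `soloLie_borelPair_Q_nonpos` — the second-order form of Lemma B over the Borel pair,
  `Q_c(h) = ½ Σ_{j<i} (c_j − c_i) h_{ji} h_{ij}`, is `≤ 0` on antisymmetric `h` when `c` is antitone
  (the local re-proof of Theorem 1: `Q_c` is negative on `𝔰𝔬_n`).
-/

set_option linter.dupNamespace false

namespace Summit.MatrixMultiplication.MatrixMultiplication.Theorems

/-- CENTRAL TWIST LEMMA (LieExponent §3.21(g)).  TPP for a triple `(S₁, S₂, S₃)` of subsets of a
group means: `q₁ q₂ q₃ = 1` with `qᵢ = a a'⁻¹`, `a, a' ∈ Sᵢ`, forces `a = a'` in each slot.  If the third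
member is a subgroup `H₃` and `z m` is central and lies in `H₃` for every `m ∈ M₁`, then replacing
`M₁` by `{z m * m : m ∈ M₁}` preserves the property (the central factor is absorbed into the `H₃`
quotient). -/
theorem soloLie_central_twist_tpp {G : Type*} [Group G] (M₁ M₂ : Set G) (H₃ : Subgroup G)
    (z : G → G) (hzc : ∀ m ∈ M₁, z m ∈ Subgroup.center G) (hzH : ∀ m ∈ M₁, z m ∈ H₃)
    (htpp : ∀ m ∈ M₁, ∀ m' ∈ M₁, ∀ n ∈ M₂, ∀ n' ∈ M₂, ∀ h ∈ H₃, ∀ h' ∈ H₃,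
      m * m'⁻¹ * (n * n'⁻¹) * (h * h'⁻¹) = 1 → m = m' ∧ n = n' ∧ h = h') :
    ∀ m ∈ M₁, ∀ m' ∈ M₁, ∀ n ∈ M₂, ∀ n' ∈ M₂, ∀ h ∈ H₃, ∀ h' ∈ H₃,
      (z m * m) * (z m' * m')⁻¹ * (n * n'⁻¹) * (h * h'⁻¹) = 1 → m = m' ∧ n = n' ∧ h = h' := by
  intro m hm m' hm' n hn n' hn' h hh h' hh' heq
  -- the central correction
  set c : G := z m * (z m')⁻¹ with hc
  have hzm : ∀ g : G, g * z m = z m * g := Subgroup.mem_center_iff.mp (hzc m hm)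
  have hzm' : ∀ g : G, g * (z m')⁻¹ = (z m')⁻¹ * g :=
    Subgroup.mem_center_iff.mp (Subgroup.inv_mem _ (hzc m' hm'))
  have hcc : ∀ g : G, g * c = c * g := by
    intro g
    calc g * c = g * z m * (z m')⁻¹ := by rw [hc, mul_assoc]
      _ = z m * g * (z m')⁻¹ := by rw [hzm g]
      _ = z m * (g * (z m')⁻¹) := by rw [mul_assoc]
      _ = z m * ((z m')⁻¹ * g) := by rw [hzm' g]
      _ = c * g := by rw [hc, mul_assoc]
  have hcH : c * h ∈ H₃ :=
    H₃.mul_mem (H₃.mul_mem (hzH m hm) (H₃.inv_mem (hzH m' hm'))) hh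
  -- rewrite the twisted quotient
  have h1 : (z m * m) * (z m' * m')⁻¹ = (m * m'⁻¹) * c := by
    rw [mul_inv_rev]
    calc z m * m * (m'⁻¹ * (z m')⁻¹) = z m * (m * m'⁻¹) * (z m')⁻¹ := by simp only [mul_assoc]
      _ = (m * m'⁻¹) * z m * (z m')⁻¹ := by rw [← hzm (m * m'⁻¹)]
      _ = (m * m'⁻¹) * c := by rw [hc, mul_assoc]
  have key : m * m'⁻¹ * (n * n'⁻¹) * ((c * h) * h'⁻¹) = 1 := by
    have h2 : m * m'⁻¹ * (n * n'⁻¹) * ((c * h) * h'⁻¹)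
        = (m * m'⁻¹) * c * (n * n'⁻¹) * (h * h'⁻¹) := by
      calc m * m'⁻¹ * (n * n'⁻¹) * ((c * h) * h'⁻¹)
          = m * m'⁻¹ * ((n * n'⁻¹) * c) * (h * h'⁻¹) := by simp only [mul_assoc]
        _ = m * m'⁻¹ * (c * (n * n'⁻¹)) * (h * h'⁻¹) := by rw [hcc (n * n'⁻¹)]
        _ = (m * m'⁻¹) * c * (n * n'⁻¹) * (h * h'⁻¹) := by simp only [mul_assoc]
    rw [h2, ← h1]
    exact heq
  obtain ⟨hmm, hnn, hch⟩ := htpp m hm m' hm' n hn n' hn' (c * h) hcH h' hh' key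
  refine ⟨hmm, hnn, ?_⟩
  have hc1 : c = 1 := by rw [hc, hmm, mul_inv_cancel]
  rw [hc1, one_mul] at hch
  exact hch

/-- SIGN OF THE BOREL-PAIR SECOND-ORDER FORM (LieExponent §3.21(g), Lemma B over the pair
`(N⁺, T_c N⁻)` of `GL_n(ℝ)`): for an antitone weight `c` and an antisymmetric matrix `h`,
`Σ_{j<i} (c_j − c_i) h_{ji} h_{ij} ≤ 0` — each term equals `−(c_j − c_i) h_{ij}²`.  This is the
two-line local re-proof that Theorem 1's third member `𝔰𝔬_n` lies on the negative side of `Q_c`. -/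
theorem soloLie_borelPair_Q_nonpos {n : ℕ} (c : Fin n → ℝ) (hc : Antitone c)
    (h : Matrix (Fin n) (Fin n) ℝ) (hh : h.transpose = -h) :
    (∑ i : Fin n, ∑ j : Fin n, if j < i then (c j - c i) * h j i * h i j else 0) ≤ 0 := by
  apply Finset.sum_nonpos
  intro i _
  apply Finset.sum_nonpos
  intro j _
  split_ifs with hji
  · have h1 : h j i = -h i j := by
      have := congrFun (congrFun hh i) j
      simpa [Matrix.transpose_apply, Matrix.neg_apply] using this
    have h2 : c i ≤ c j := hc (le_of_lt hji)
    rw [h1]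
    nlinarith [sq_nonneg (h i j), h2, mul_nonneg (sub_nonneg.mpr h2) (sq_nonneg (h i j))]
  · exact le_refl 0

/-- Strict version: if moreover `c` is strictly antitone and `h ≠ 0` is antisymmetric, the form is
`< 0` — `Q_c` is negative DEFINITE on `𝔰𝔬_n`, which with Lemma B(ii) gives the local triple product
property of `(SO_n, N⁺, T_c N⁻)` near the identity. -/
theorem soloLie_borelPair_Q_neg {n : ℕ} (c : Fin n → ℝ) (hc : StrictAnti c)
    (h : Matrix (Fin n) (Fin n) ℝ) (hh : h.transpose = -h) (hne : h ≠ 0) :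
    (∑ i : Fin n, ∑ j : Fin n, if j < i then (c j - c i) * h j i * h i j else 0) < 0 := by
  -- every term is ≤ 0
  have hanti : ∀ i j : Fin n, h j i = -h i j := by
    intro i j
    have := congrFun (congrFun hh i) j
    simpa [Matrix.transpose_apply, Matrix.neg_apply] using this
  have hterm : ∀ i j : Fin n, (if j < i then (c j - c i) * h j i * h i j else 0) ≤ 0 := by
    intro i j
    split_ifs with hji
    · have h2 : c i < c j := hc hji
      rw [hanti i j]
      nlinarith [sq_nonneg (h i j), h2, mul_nonneg (sub_nonneg.mpr h2.le) (sq_nonneg (h i j))]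
    · exact le_refl 0
  -- some entry off the diagonal is nonzero; the diagonal vanishes by antisymmetry
  have hdiag : ∀ i : Fin n, h i i = 0 := by
    intro i
    have := hanti i i
    linarith
  obtain ⟨i₀, j₀, hij⟩ : ∃ i j : Fin n, h i j ≠ 0 := by
    by_contra hcon
    push Not at hcon
    exact hne (Matrix.ext fun i j => by simpa using hcon i j)
  have hneq : i₀ ≠ j₀ := by
    rintro rfl
    exact hij (hdiag i₀)
  -- arrange j < i with h i j ≠ 0
  obtain ⟨i, j, hji, hij'⟩ : ∃ i j : Fin n, j < i ∧ h i j ≠ 0 := by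
    rcases lt_or_gt_of_ne hneq with hlt | hgt
    · refine ⟨j₀, i₀, hlt, ?_⟩
      rw [hanti j₀ i₀] at hij
      -- hij : -h j₀ i₀ ≠ 0  … wait: hanti j₀ i₀ : h i₀ j₀ = -h j₀ i₀
      intro h0
      exact hij (by rw [h0, neg_zero])
    · exact ⟨i₀, j₀, hgt, hij⟩
  have hstrict : (if j < i then (c j - c i) * h j i * h i j else 0) < 0 := by
    rw [if_pos hji, hanti i j]
    have h2 : c i < c j := hc hji
    have hsq : 0 < (h i j) ^ 2 := by positivity
    nlinarith [hsq, h2, mul_pos (sub_pos.mpr h2) hsq]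
  -- sum of nonpositive terms with one strictly negative term is negative
  calc (∑ i' : Fin n, ∑ j' : Fin n, if j' < i' then (c j' - c i') * h j' i' * h i' j' else 0)
      ≤ ∑ j' : Fin n, (if j' < i then (c j' - c i) * h j' i * h i j' else 0) := by
        rw [← Finset.sum_erase_add _ _ (Finset.mem_univ i)]
        have : (∑ x ∈ Finset.univ.erase i, ∑ j' : Fin n,
            if j' < x then (c j' - c x) * h j' x * h x j' else 0) ≤ 0 :=
          Finset.sum_nonpos fun x _ => Finset.sum_nonpos fun j' _ => hterm x j'
        linarith
    _ < 0 := by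
        rw [← Finset.sum_erase_add _ _ (Finset.mem_univ j)]
        have : (∑ x ∈ Finset.univ.erase j,
            if x < i then (c x - c i) * h x i * h i x else 0) ≤ 0 :=
          Finset.sum_nonpos fun x _ => hterm i x
        linarith

end Summit.MatrixMultiplication.MatrixMultiplication.Theorems
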